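import Mathlib
import HarnessLib

/-!
# BalabanIR engine `BirComplexStableXYR` (stmt-HubbardSuperconductivity-14845), line
# `fat_gaussian_defect_calculus`, chapter T-end: the elementary trace bound

Generic (project-definition-free) piece of the elementary dominant-eigenvalue analysis of the effective
1-D transfer operator.  The T-end lemma gives an operator-norm estimate `‖tⁿ - μⁿ p‖ ≤ θ₁ⁿ`; to pass to
traces (partition functions) on a finite-dimensional truncation one needs the elementary bound
`|tr A| ≤ (dim E) · ‖A‖`.

`stub_traceNormBound`: for a bounded operator `A` on a finite-dimensional complex inner-product space `E`,
`‖LinearMap.trace ℂ E A‖ ≤ (Module.finrank ℂ E) * ‖A‖`.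

Proof: with `b := stdOrthonormalBasis ℂ E` (indexed by `Fin (finrank ℂ E)`), Mathlib's
`LinearMap.trace_eq_sum_inner` gives `tr A = ∑ i, ⟪b i, A (b i)⟫`; each term has norm
`≤ ‖b i‖ * ‖A (b i)‖ ≤ ‖b i‖ * (‖A‖ * ‖b i‖) = ‖A‖` (`norm_inner_le_norm`, `ContinuousLinearMap.le_opNorm`,
`‖b i‖ = 1`), and there are `finrank ℂ E` terms (`norm_sum_le`, `Finset.sum_const`). [folklore]
-/

set_option linter.dupNamespace false -- summit = problem name (single-conjunct summit), D-0017

namespace Summit.HubbardSuperconductivity.HubbardSuperconductivity.Theorems.TEnd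

open scoped InnerProductSpace

/-- Elementary trace bound.  For a bounded operator `A` on a finite-dimensional complex inner-product
space `E`, `‖tr A‖ ≤ (finrank ℂ E) * ‖A‖`: expand the trace in the standard orthonormal basis
(`LinearMap.trace_eq_sum_inner`) and bound each diagonal entry `⟪b i, A (b i)⟫` by `‖A‖`.
[folklore] -/
theorem stub_traceNormBound :
    ∀ (E : Type) [NormedAddCommGroup E] [InnerProductSpace ℂ E] [FiniteDimensional ℂ E] (A : E →L[ℂ] E),
      ‖LinearMap.trace ℂ E (A : E →ₗ[ℂ] E)‖ ≤ (Module.finrank ℂ E : ℝ) * ‖A‖ := by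
  intro E _ _ _ A
  set b : OrthonormalBasis (Fin (Module.finrank ℂ E)) ℂ E := stdOrthonormalBasis ℂ E
  rw [LinearMap.trace_eq_sum_inner (A : E →ₗ[ℂ] E) b]
  calc ‖∑ i, ⟪b i, (A : E →ₗ[ℂ] E) (b i)⟫_ℂ‖ ≤ ∑ i, ‖⟪b i, (A : E →ₗ[ℂ] E) (b i)⟫_ℂ‖ :=
        norm_sum_le _ _
    _ ≤ ∑ _i : Fin (Module.finrank ℂ E), ‖A‖ := by
        refine Finset.sum_le_sum fun i _ => ?_
        calc ‖⟪b i, (A : E →ₗ[ℂ] E) (b i)⟫_ℂ‖ ≤ ‖b i‖ * ‖(A : E →ₗ[ℂ] E) (b i)‖ := norm_inner_le_norm _ _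
          _ ≤ ‖b i‖ * (‖A‖ * ‖b i‖) := by
              gcongr
              exact A.le_opNorm (b i)
          _ = ‖A‖ := by
              rw [b.orthonormal.1 i]
              ring
    _ = (Module.finrank ℂ E : ℝ) * ‖A‖ := by
        rw [Finset.sum_const, Finset.card_univ, Fintype.card_fin, nsmul_eq_mul]

end Summit.HubbardSuperconductivity.HubbardSuperconductivity.Theorems.TEnd
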